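import Summits.HodgeConjecture.HodgeConjecture.Theorems.R90S7QsSelfSimilitudeInner                 -- ★ part 1∕3: `map_conjLocal_transpose_qsForm` (`Φ₃ ⊗ 1` is hermitian)
import Literature.NumberTheory.Automorphic.LocalRegularOrbitClosed                                  -- ★ `map_conjLocal_transpose_localForm`
import Literature.NumberTheory.Automorphic.UnitaryGroupFrameSubform                                 -- ★ `conj_mem_unitaryGroupOfForm_iff`
import HarnessLib

/-!
# R90-TF · S7 (Ch. 14.6-tuple, C146) · S7-J2★ «O2 JUNCTION», PART 2∕3 (L0) — a CONJUGATOR of `U(H)(L⁺_v)` onto `U(Φ₃)(L⁺_v)` IS a form similitude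
# ([Rogawski1990, §14.1 p. 232 «we fix an inner isomorphism ψ : G′ → G»; §1.9 p. 8; §12.1 p. 171], [PlatonovRapinchuk1994, §2.3])

Cell `hodgecm-mathlib`, crux H413 (`stmt-HodgeConjecture-24833`), route of record `HCCMUnconditional`; programme R90-TF (brief `director/R90-BRIEF.v2.md`
1f40d54518340a35), section S7 = Rogawski §14.6 (base `R90-C146`), seat R90-C146-p01 (g0); deal S7-R8∕S7-J2★ (LH7-plan (g4)) under RULING S7-R12 «FLAG F-ψ IS RESOLVED
BY THE TREE, BY NAME»: the kit's pin (vii-c) ★ `ComparisonKit.PinPsiConj` says `ψ_v g = S⁻¹ g S` for some `S ∈ GL₃(L ⊗ L⁺_v)`; this file turns that into the tree's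
congruence currency.  Helper file 2∕3 of the junction `Theorems/R90S7RigidCoreOfQsRigidity.lean`, lane `--supports stmt-HodgeConjecture-24833 --as helper`; LEAF-FREE,
KIT-FREE; theorems only (no `def`, no instance, no notation, no `sorry`).

CONTENT.  (L0) `exists_formCongr_of_conj`: if `ψ_v : U(H)_v ≃ₜ* U(Φ₃)_v` is `g ↦ S⁻¹ g S` then `ᵗ(σS) · H_v · S = m · Φ₃` for a `σ`-fixed UNIT `m`, and
`ψ_v = (cmDatumLocalCongr L v S hm h).symm` — print's «inner isomorphism `ψ`» [§14.1 p. 232] as a form congruence.  Proof: every `u ∈ U(Φ₃)_v` is `S⁻¹ g S` with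
`g ∈ U(H)_v`, so `U(Φ₃)_v` preserves `Ψ := ᵗ(σS) H S`; then `Φ₃ Ψ` commutes with `U(Φ₃)_v`, in particular with the two rational test elements `d = diag(2, 1, ½)` and the
unipotent `n = [[1,2,−2],[0,1,−2],[0,0,1]]` of `U(Φ₃)(L⁺)` (`exists_testDiag`, `exists_testUnip`), which forces it to be scalar (`eq_smul_one_of_commute_test`,
`exists_eq_smul_qsForm_of_forall_mem` — the centraliser of `U(Φ₃)_v` in `M₃(L ⊗ L⁺_v)` is scalar); `m` is a unit by determinants and `σ`-fixed because both forms are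
hermitian.

HONEST LABEL: local algebra closes no citation.  HC_CM is proved only modulo the 7 printed citations (2 remaining named inputs: hLiu418 = stmt-HodgeConjecture-24832,
h413 = stmt-HodgeConjecture-24833) — until rung 0 closes.

## References
* [Rogawski1990] J. D. Rogawski, *Automorphic Representations of Unitary Groups in Three Variables*, Ann. of Math. Stud. 123 (1990): §1.9 p. 8; §12.1 p. 171; §14.1 p. 232.
* [PlatonovRapinchuk1994] V. Platonov, A. Rapinchuk, *Algebraic Groups and Number Theory* (1994), §2.3.
-/

set_option autoImplicit false
-- the mandated namespace repeats the single-problem summit's segment (`HodgeConjecture.HodgeConjecture`)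
set_option linter.dupNamespace false

noncomputable section

open NumberField IsDedekindDomain
open scoped Matrix MatrixGroups

namespace Summit.HodgeConjecture.HodgeConjecture.R90.S7

open Literature.NumberTheory Literature.NumberTheory.Automorphic Literature.NumberTheory.Automorphic.UnitaryGroup
open Literature.NumberTheory.Rogawski1990

/-! ## §2 (L0) A conjugator of `U(H)(L⁺_v)` onto `U(Φ₃)(L⁺_v)` is a similitude -/

section Conjugator

variable (L : Type) [Field L] [NumberField L] [IsCMField L] (v : HeightOneSpectrum (𝓞 ↥(maximalRealSubfield L)))

omit [NumberField L] [IsCMField L] in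
/-- `n · n⁻¹ = 1`. [cite: Rogawski1990, §12.1 p. 171] -/
theorem testUnip_mul_testUnipInv : (!![1, 2, -2; 0, 1, -2; 0, 0, 1] : Matrix (Fin 3) (Fin 3) L) * (!![1, -2, -2; 0, 1, 2; 0, 0, 1] : Matrix (Fin 3) (Fin 3) L) = 1 := by
  ext i j
  fin_cases i <;> fin_cases j <;> simp [Matrix.mul_apply, Fin.sum_univ_three]
  all_goals norm_num

omit [NumberField L] [IsCMField L] in
/-- `n⁻¹ · n = 1`. [cite: Rogawski1990, §12.1 p. 171] -/
theorem testUnipInv_mul_testUnip : (!![1, -2, -2; 0, 1, 2; 0, 0, 1] : Matrix (Fin 3) (Fin 3) L) * (!![1, 2, -2; 0, 1, -2; 0, 0, 1] : Matrix (Fin 3) (Fin 3) L) = 1 := by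
  ext i j
  fin_cases i <;> fin_cases j <;> simp [Matrix.mul_apply, Fin.sum_univ_three]
  all_goals norm_num

omit [NumberField L] [IsCMField L] in
/-- `ᵗn · Φ₃ · n = Φ₃` over `L` (the entries of `n` are rational integers, so no conjugation enters). [cite: Rogawski1990, §12.1 p. 171] -/
theorem testUnip_transpose_mul_qsForm_mul : (!![1, 2, -2; 0, 1, -2; 0, 0, 1] : Matrix (Fin 3) (Fin 3) L)ᵀ * qsForm L * (!![1, 2, -2; 0, 1, -2; 0, 0, 1] : Matrix (Fin 3) (Fin 3) L) = qsForm L := by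
  ext i j
  fin_cases i <;> fin_cases j <;> simp [qsForm, Matrix.mul_apply, Fin.sum_univ_three, Matrix.of_apply]
  all_goals norm_num

omit [IsCMField L] in
/-- `d · d⁻¹ = 1` entrywise. [cite: Rogawski1990, §12.1 p. 171] -/
theorem testDiagVals_mul_testDiagInvVals : (fun i => (fun i : Fin 3 => if i.val = 0 then (2 : L) else if i.val = 1 then 1 else 2⁻¹) i * (fun i : Fin 3 => if i.val = 0 then (2⁻¹ : L) else if i.val = 1 then 1 else 2) i) = fun _ => 1 := by
  funext i
  fin_cases i <;> simp

omit [IsCMField L] in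
/-- `d⁻¹ · d = 1` entrywise. [cite: Rogawski1990, §12.1 p. 171] -/
theorem testDiagInvVals_mul_testDiagVals : (fun i => (fun i : Fin 3 => if i.val = 0 then (2⁻¹ : L) else if i.val = 1 then 1 else 2) i * (fun i : Fin 3 => if i.val = 0 then (2 : L) else if i.val = 1 then 1 else 2⁻¹) i) = fun _ => 1 := by
  funext i
  fin_cases i <;> simp

omit [IsCMField L] in
/-- `ᵗd · Φ₃ · d = Φ₃` over `L` for `d = diag(2, 1, 2⁻¹)`. [cite: Rogawski1990, §12.1 p. 171] -/
theorem testDiag_transpose_mul_qsForm_mul :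
    (Matrix.diagonal (fun i : Fin 3 => if i.val = 0 then (2 : L) else if i.val = 1 then 1 else 2⁻¹))ᵀ * qsForm L * Matrix.diagonal (fun i : Fin 3 => if i.val = 0 then (2 : L) else if i.val = 1 then 1 else 2⁻¹) = qsForm L := by
  rw [Matrix.diagonal_transpose]
  ext i j
  rw [Matrix.mul_diagonal, Matrix.diagonal_mul]
  fin_cases i <;> fin_cases j <;> simp [qsForm, Matrix.of_apply]

omit [NumberField L] [IsCMField L] in
/-- `Φ₃ · Φ₃ = 1`. [cite: Rogawski1990, §1.9 p. 8] -/
theorem qsForm_mul_qsForm : qsForm L * qsForm L = 1 := by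
  ext i j
  fin_cases i <;> fin_cases j <;> simp [qsForm, Matrix.mul_apply, Fin.sum_univ_three, Matrix.of_apply]

/-- The CM conjugation fixes the integral test matrix: `c(n) = n`. [cite: Rogawski1990, §12.1 p. 171] -/
theorem testUnip_map_cmConj : (!![1, 2, -2; 0, 1, -2; 0, 0, 1] : Matrix (Fin 3) (Fin 3) L).map (IsCMField.complexConj L) = (!![1, 2, -2; 0, 1, -2; 0, 0, 1] : Matrix (Fin 3) (Fin 3) L) := by
  ext i j
  fin_cases i <;> fin_cases j <;> simp [map_ofNat]

/-- `c(d) = d`. [cite: Rogawski1990, §12.1 p. 171] -/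
theorem testDiag_map_cmConj : (Matrix.diagonal (fun i : Fin 3 => if i.val = 0 then (2 : L) else if i.val = 1 then 1 else 2⁻¹)).map (IsCMField.complexConj L) = Matrix.diagonal (fun i : Fin 3 => if i.val = 0 then (2 : L) else if i.val = 1 then 1 else 2⁻¹) := by
  rw [Matrix.diagonal_map (map_zero _)]
  congr 1
  funext i
  fin_cases i <;> simp [map_ofNat]

omit [IsCMField L] in
/-- `Φ₃ ⊗ 1` squares to `1`. [cite: Rogawski1990, §1.9 p. 8] -/
theorem qsForm_map_mul_self :
    (qsForm L).map (algebraMap L (LocalRing L v)) * (qsForm L).map (algebraMap L (LocalRing L v)) = 1 := by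
  rw [← Matrix.map_mul, qsForm_mul_qsForm, Matrix.map_one _ (map_zero _) (map_one _)]

/-- A rational matrix read over `L ⊗ L⁺_v` and conjugated by `c ⊗ 1` is the conjugated matrix read over `L ⊗ L⁺_v`. [cite: Rogawski1990, §1.9 p. 8] -/
theorem map_algebraMap_map_conjLocal (A : Matrix (Fin 3) (Fin 3) L) :
    (A.map (algebraMap L (LocalRing L v))).map (conjLocal L (IsCMField.complexConj L) v) =
      (A.map (IsCMField.complexConj L)).map (algebraMap L (LocalRing L v)) := by
  rw [Matrix.map_map, Matrix.map_map]
  congr 1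
  funext x
  simp only [Function.comp_apply, conjLocal_algebraMap]

/-- **Membership of a base-changed rational matrix in `U(Φ₃)(L⁺_v)`**: if `ᵗ(cA) · Φ₃ · A = Φ₃` over `L` then `A ⊗ 1 ∈ U(Φ₃ ⊗ 1)`. [cite: Rogawski1990, §1.9 p. 8] -/
theorem map_mem_unitaryGroupOfForm_qsForm (A : GL (Fin 3) (LocalRing L v)) (A₀ : Matrix (Fin 3) (Fin 3) L)
    (hA : A.val = A₀.map (algebraMap L (LocalRing L v)))
    (hc : A₀.map (IsCMField.complexConj L) = A₀) (h : A₀ᵀ * qsForm L * A₀ = qsForm L) :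
    A ∈ «local» L (IsCMField.complexConj L) 3 (qsForm L) v := by
  rw [local_eq_unitaryGroupOfForm_map, mem_unitaryGroupOfForm_iff]
  change ((A.val).map _)ᵀ * _ * A.val = _
  rw [hA, map_algebraMap_map_conjLocal, hc, ← Matrix.transpose_map, ← Matrix.map_mul, ← Matrix.map_mul, h]

/-- **The test element `d ⊗ 1 = diag(2,1,½) ∈ U(Φ₃)(L⁺_v)` exists** (a unit of `M₃(L ⊗ L⁺_v)` preserving `Φ₃ ⊗ 1`). [cite: Rogawski1990, §12.1 p. 171] -/
theorem exists_testDiag : ∃ d : Gqs L v, d.val.val = (Matrix.diagonal (fun i : Fin 3 => if i.val = 0 then (2 : L) else if i.val = 1 then 1 else 2⁻¹)).map (algebraMap L (LocalRing L v)) := by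
  refine ⟨⟨⟨(Matrix.diagonal (fun i : Fin 3 => if i.val = 0 then (2 : L) else if i.val = 1 then 1 else 2⁻¹)).map (algebraMap L (LocalRing L v)),
    (Matrix.diagonal (fun i : Fin 3 => if i.val = 0 then (2⁻¹ : L) else if i.val = 1 then 1 else 2)).map (algebraMap L (LocalRing L v)), ?_, ?_⟩, ?_⟩, rfl⟩
  · rw [← Matrix.map_mul, Matrix.diagonal_mul_diagonal, testDiagVals_mul_testDiagInvVals, Matrix.diagonal_one,
      Matrix.map_one _ (map_zero _) (map_one _)]
  · rw [← Matrix.map_mul, Matrix.diagonal_mul_diagonal, testDiagInvVals_mul_testDiagVals, Matrix.diagonal_one,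
      Matrix.map_one _ (map_zero _) (map_one _)]
  · exact map_mem_unitaryGroupOfForm_qsForm L v _ _ rfl (testDiag_map_cmConj L) (testDiag_transpose_mul_qsForm_mul L)

/-- **The test element `n ⊗ 1 ∈ U(Φ₃)(L⁺_v)` exists** (the integral unipotent `[[1,2,-2],[0,1,-2],[0,0,1]]`). [cite: Rogawski1990, §12.1 p. 171] -/
theorem exists_testUnip : ∃ n : Gqs L v, n.val.val = (!![1, 2, -2; 0, 1, -2; 0, 0, 1] : Matrix (Fin 3) (Fin 3) L).map (algebraMap L (LocalRing L v)) := by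
  refine ⟨⟨⟨(!![1, 2, -2; 0, 1, -2; 0, 0, 1] : Matrix (Fin 3) (Fin 3) L).map (algebraMap L (LocalRing L v)), (!![1, -2, -2; 0, 1, 2; 0, 0, 1] : Matrix (Fin 3) (Fin 3) L).map (algebraMap L (LocalRing L v)), ?_, ?_⟩, ?_⟩, rfl⟩
  · rw [← Matrix.map_mul, testUnip_mul_testUnipInv, Matrix.map_one _ (map_zero _) (map_one _)]
  · rw [← Matrix.map_mul, testUnipInv_mul_testUnip, Matrix.map_one _ (map_zero _) (map_one _)]
  · exact map_mem_unitaryGroupOfForm_qsForm L v _ _ rfl (testUnip_map_cmConj L) (testUnip_transpose_mul_qsForm_mul L)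

omit [IsCMField L] in
/-- **THE CENTRALISER OF `U(Φ₃)(L⁺_v)` IN `M₃(L ⊗ L⁺_v)` IS SCALAR** (elementary form): a matrix commuting with the two rational test elements `d ⊗ 1 = diag(2,1,½)` and the
unipotent `n ⊗ 1` is a scalar (`d` has unit entry differences, so the commutant is diagonal; `n` links the three diagonal entries). [cite: Rogawski1990, §12.1 p. 171] -/
theorem eq_smul_one_of_commute_test (M : Matrix (Fin 3) (Fin 3) (LocalRing L v))
    (hD : M * (Matrix.diagonal (fun i : Fin 3 => if i.val = 0 then (2 : L) else if i.val = 1 then 1 else 2⁻¹)).map (algebraMap L (LocalRing L v)) =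
      (Matrix.diagonal (fun i : Fin 3 => if i.val = 0 then (2 : L) else if i.val = 1 then 1 else 2⁻¹)).map (algebraMap L (LocalRing L v)) * M)
    (hN : M * (!![1, 2, -2; 0, 1, -2; 0, 0, 1] : Matrix (Fin 3) (Fin 3) L).map (algebraMap L (LocalRing L v)) = (!![1, 2, -2; 0, 1, -2; 0, 0, 1] : Matrix (Fin 3) (Fin 3) L).map (algebraMap L (LocalRing L v)) * M) :
    M = M 0 0 • (1 : Matrix (Fin 3) (Fin 3) (LocalRing L v)) := by
  rw [Matrix.diagonal_map (map_zero _)] at hD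
  -- off-diagonal entries vanish: `M i j · (d j − d i) = 0` with `d j − d i` a unit
  have hoff : ∀ i j : Fin 3, i ≠ j → M i j = 0 := by
    intro i j hij
    have h := congrFun (congrFun hD i) j
    rw [Matrix.mul_diagonal, Matrix.diagonal_mul] at h
    -- `h : M i j * d j = d i * M i j`
    have hne : (fun i : Fin 3 => if i.val = 0 then (2 : L) else if i.val = 1 then 1 else 2⁻¹) j - (fun i : Fin 3 => if i.val = 0 then (2 : L) else if i.val = 1 then 1 else 2⁻¹) i ≠ 0 := by
      fin_cases i <;> fin_cases j <;> first | exact absurd rfl hij | norm_num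
    have hunit : IsUnit (algebraMap L (LocalRing L v) ((fun i : Fin 3 => if i.val = 0 then (2 : L) else if i.val = 1 then 1 else 2⁻¹) j) - algebraMap L (LocalRing L v) ((fun i : Fin 3 => if i.val = 0 then (2 : L) else if i.val = 1 then 1 else 2⁻¹) i)) := by
      rw [← map_sub]; exact (IsUnit.mk0 _ hne).map (algebraMap L (LocalRing L v))
    have hzero : M i j * (algebraMap L (LocalRing L v) ((fun i : Fin 3 => if i.val = 0 then (2 : L) else if i.val = 1 then 1 else 2⁻¹) j) - algebraMap L (LocalRing L v) ((fun i : Fin 3 => if i.val = 0 then (2 : L) else if i.val = 1 then 1 else 2⁻¹) i)) = 0 := by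
      rw [mul_sub, h, mul_comm, sub_self]
    exact (hunit.mul_left_eq_zero).1 hzero
  -- the diagonal entries agree: read `M n = n M` at `(0,1)` and `(1,2)`
  have h01 := congrFun (congrFun hN 0) 1
  have h12 := congrFun (congrFun hN 1) 2
  simp only [Matrix.mul_apply, Fin.sum_univ_three, Matrix.map_apply] at h01 h12
  simp [hoff 0 1 (by decide), hoff 0 2 (by decide), hoff 1 0 (by decide), hoff 1 2 (by decide), hoff 2 1 (by decide)] at h01 h12
  -- `h01 : M 0 0 * 2 = 2 * M 1 1`, `h12 : M 1 1 * 2 = 2 * M 2 2`; cancel the unit `2`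
  have h2 : IsUnit (algebraMap L (LocalRing L v) 2) := (IsUnit.mk0 (2 : L) two_ne_zero).map (algebraMap L (LocalRing L v))
  have h11 : M 1 1 = M 0 0 := (h2.mul_left_cancel (by rw [← h01, mul_comm])).symm
  have h22 : M 2 2 = M 0 0 := by
    have h' : M 2 2 = M 1 1 := (h2.mul_left_cancel (by rw [← h12, mul_comm])).symm
    rw [h', h11]
  ext i j
  fin_cases i <;> fin_cases j <;>
    simp [Matrix.smul_apply, hoff 0 1 (by decide), hoff 0 2 (by decide), hoff 1 0 (by decide), hoff 1 2 (by decide),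
      hoff 2 0 (by decide), hoff 2 1 (by decide), h11, h22]

/-- **A COMMON STABILISER IS CENTRAL**: if every `u ∈ U(Φ₃)(L⁺_v)` also preserves the form `Ψ`, then `Ψ = m • Φ₃` for the scalar `m = (Φ₃ Ψ)₀₀` — `Φ₃ · Ψ` commutes with
`U(Φ₃)(L⁺_v)` (`ᵗū = Φ₃ u⁻¹ Φ₃`), hence with the two test elements, hence is scalar. [cite: Rogawski1990, §1.9 p. 8; §12.1 p. 171] [cite: PlatonovRapinchuk1994, §2.3] -/
theorem exists_eq_smul_qsForm_of_forall_mem (Ψ : Matrix (Fin 3) (Fin 3) (LocalRing L v))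
    (hΨ : ∀ u : Gqs L v, u.val ∈ unitaryGroupOfForm (conjLocal L (IsCMField.complexConj L) v) Ψ) :
    ∃ m : LocalRing L v, Ψ = m • (qsForm L).map (algebraMap L (LocalRing L v)) := by
  -- `Φ Ψ` commutes with every `u ∈ U(Φ₃)(L⁺_v)`
  have hcomm : ∀ u : Gqs L v, (qsForm L).map (algebraMap L (LocalRing L v)) * Ψ * u.val.val =
      u.val.val * ((qsForm L).map (algebraMap L (LocalRing L v)) * Ψ) := by
    intro u
    have h1 : ((u.val.val).map (conjLocal L (IsCMField.complexConj L) v))ᵀ * (qsForm L).map (algebraMap L (LocalRing L v)) * u.val.val =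
        (qsForm L).map (algebraMap L (LocalRing L v)) := by
      have hu : u.val ∈ unitaryGroupOfForm (conjLocal L (IsCMField.complexConj L) v) ((qsForm L).map (algebraMap L (LocalRing L v))) := by
        rw [← local_eq_unitaryGroupOfForm_map]; exact u.2
      exact (mem_unitaryGroupOfForm_iff).1 hu
    have h2 : ((u.val.val).map (conjLocal L (IsCMField.complexConj L) v))ᵀ * Ψ * u.val.val = Ψ := (mem_unitaryGroupOfForm_iff).1 (hΨ u)
    -- cancel the unit `ᵗū`
    have hunit : IsUnit ((u.val.val).map (conjLocal L (IsCMField.complexConj L) v))ᵀ := by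
      rw [Matrix.isUnit_iff_isUnit_det, Matrix.det_transpose, ← RingHom.mapMatrix_apply, ← RingHom.map_det]
      exact (Matrix.isUnits_det_units _).map _
    have h3 : ((u.val.val).map (conjLocal L (IsCMField.complexConj L) v))ᵀ *
        ((qsForm L).map (algebraMap L (LocalRing L v)) * u.val.val * ((qsForm L).map (algebraMap L (LocalRing L v)) * Ψ)) =
        ((u.val.val).map (conjLocal L (IsCMField.complexConj L) v))ᵀ * (Ψ * u.val.val) := by
      calc _ = ((u.val.val).map (conjLocal L (IsCMField.complexConj L) v))ᵀ * (qsForm L).map (algebraMap L (LocalRing L v)) * u.val.val *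
            (qsForm L).map (algebraMap L (LocalRing L v)) * Ψ := by
              simp only [Matrix.mul_assoc]
        _ = (qsForm L).map (algebraMap L (LocalRing L v)) * (qsForm L).map (algebraMap L (LocalRing L v)) * Ψ := by rw [h1]
        _ = Ψ := by rw [qsForm_map_mul_self, Matrix.one_mul]
        _ = _ := by rw [← Matrix.mul_assoc, h2]
    have h4 := hunit.mul_left_cancel h3
    -- `Φ u Φ Ψ = Ψ u` ⇒ `u (Φ Ψ) = Φ Ψ u` after multiplying by `Φ` (`Φ² = 1`)
    calc (qsForm L).map (algebraMap L (LocalRing L v)) * Ψ * u.val.val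
        = (qsForm L).map (algebraMap L (LocalRing L v)) * (Ψ * u.val.val) := Matrix.mul_assoc _ _ _
      _ = (qsForm L).map (algebraMap L (LocalRing L v)) *
            ((qsForm L).map (algebraMap L (LocalRing L v)) * u.val.val * ((qsForm L).map (algebraMap L (LocalRing L v)) * Ψ)) := by rw [h4]
      _ = ((qsForm L).map (algebraMap L (LocalRing L v)) * (qsForm L).map (algebraMap L (LocalRing L v))) *
            (u.val.val * ((qsForm L).map (algebraMap L (LocalRing L v)) * Ψ)) := by
            simp only [Matrix.mul_assoc]
      _ = _ := by rw [qsForm_map_mul_self, Matrix.one_mul]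
  obtain ⟨d, hd⟩ := exists_testDiag L v
  obtain ⟨n, hn⟩ := exists_testUnip L v
  have hD := hcomm d
  have hN := hcomm n
  rw [hd] at hD
  rw [hn] at hN
  have hscal := eq_smul_one_of_commute_test L v ((qsForm L).map (algebraMap L (LocalRing L v)) * Ψ) hD hN
  refine ⟨((qsForm L).map (algebraMap L (LocalRing L v)) * Ψ) 0 0, ?_⟩
  calc Ψ = (qsForm L).map (algebraMap L (LocalRing L v)) * (qsForm L).map (algebraMap L (LocalRing L v)) * Ψ := by
          rw [qsForm_map_mul_self, Matrix.one_mul]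
    _ = (qsForm L).map (algebraMap L (LocalRing L v)) * ((qsForm L).map (algebraMap L (LocalRing L v)) * Ψ) := Matrix.mul_assoc _ _ _
    _ = (qsForm L).map (algebraMap L (LocalRing L v)) *
          ((((qsForm L).map (algebraMap L (LocalRing L v)) * Ψ) 0 0) • (1 : Matrix (Fin 3) (Fin 3) (LocalRing L v))) := by rw [← hscal]
    _ = (((qsForm L).map (algebraMap L (LocalRing L v)) * Ψ) 0 0) • (qsForm L).map (algebraMap L (LocalRing L v)) := by
          rw [Matrix.mul_smul, Matrix.mul_one]

/-- **L0. A CONJUGATOR OF `U(H)(L⁺_v)` ONTO `U(Φ₃)(L⁺_v)` IS A SIMILITUDE**: if `ψ_v : U(H)_v ≃ₜ* U(Φ₃)_v` is `g ↦ S⁻¹ g S` (the kit's pin (vii-c) `PinPsiConj`), then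
`ᵗS̄ · H · S = m • Φ₃` for a `(c ⊗ 1)`-fixed unit `m`, and `ψ_v` IS the form congruence `(cmDatumLocalCongr L v S hm h).symm` — print's «inner isomorphism `ψ`» [§14.1 p. 232]
in the tree's congruence currency.  (Every `u ∈ U(Φ₃)_v` is `S⁻¹ g S` with `g ∈ U(H)_v`, so `U(Φ₃)_v` preserves `ᵗS̄HS`; by `exists_eq_smul_qsForm_of_forall_mem` that form is
`m • Φ₃`; `m` is a unit by determinants and `c`-fixed because both forms are hermitian.) [cite: Rogawski1990, §14.1 p. 232; §1.9 p. 8] [cite: PlatonovRapinchuk1994, §2.3] -/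
theorem exists_formCongr_of_conj (H : Matrix (Fin 3) (Fin 3) L) (hH : (H.map (cmConjRingHom L))ᵀ = H) (hHd : IsUnit H.det)
    (ψv : (cmDatum L 3 H).Local v ≃ₜ* (cmDatum L 3 (qsForm L)).Local v) (S : GL (Fin 3) (LocalRing L v))
    (hS : ∀ g : (cmDatum L 3 H).Local v, (ψv g).val = S⁻¹ * g.val * S) :
    ∃ (m : LocalRing L v) (hm : IsUnit m) (_ : conjLocal L (IsCMField.complexConj L) v m = m)
      (h : formCongr (conjLocal L (IsCMField.complexConj L) v) S (H.map (algebraMap L (LocalRing L v))) =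
        m • (Matrix.of fun i j : Fin 3 => if i.val + j.val + 1 = 3 then (1 : L) else 0).map (algebraMap L (LocalRing L v))),
      ψv = (cmDatumLocalCongr L v S hm h).symm := by
  -- every `u ∈ U(Φ₃)_v` preserves `Ψ = ᵗS̄ H S`
  have hΨU : ∀ u : Gqs L v, u.val ∈ unitaryGroupOfForm (conjLocal L (IsCMField.complexConj L) v)
      (formCongr (conjLocal L (IsCMField.complexConj L) v) S (H.map (algebraMap L (LocalRing L v)))) := by
    intro u
    have hg : (ψv.symm u).val ∈ unitaryGroupOfForm (conjLocal L (IsCMField.complexConj L) v) (H.map (algebraMap L (LocalRing L v))) := by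
      rw [← local_eq_unitaryGroupOfForm_map]; exact (ψv.symm u).2
    have hval : S * u.val * S⁻¹ = (ψv.symm u).val := by
      have h1 := hS (ψv.symm u)
      rw [ContinuousMulEquiv.apply_symm_apply] at h1
      rw [h1]; group
    rw [← conj_mem_unitaryGroupOfForm_iff, hval]
    exact hg
  obtain ⟨m, hm⟩ := exists_eq_smul_qsForm_of_forall_mem L v _ hΨU
  -- `m` is a unit: determinants
  have hmU : IsUnit m := by
    have hdet : IsUnit (formCongr (conjLocal L (IsCMField.complexConj L) v) S (H.map (algebraMap L (LocalRing L v)))).det := by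
      rw [det_formCongr]
      refine ((((Matrix.isUnits_det_units S).map _).mul ?_).mul (Matrix.isUnits_det_units S))
      rw [← RingHom.mapMatrix_apply, ← RingHom.map_det]
      exact hHd.map _
    rw [hm, Matrix.det_smul, Fintype.card_fin] at hdet
    exact (isUnit_pow_iff three_ne_zero).1 (isUnit_of_mul_isUnit_left hdet)
  have h' : formCongr (conjLocal L (IsCMField.complexConj L) v) S (H.map (algebraMap L (LocalRing L v))) =
      m • (Matrix.of fun i j : Fin 3 => if i.val + j.val + 1 = 3 then (1 : L) else 0).map (algebraMap L (LocalRing L v)) := hm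
  -- `m` is `c ⊗ 1`-fixed: both forms are hermitian
  have hσm : conjLocal L (IsCMField.complexConj L) v m = m := by
    have hHloc : ((H.map (algebraMap L (LocalRing L v))).map (conjLocal L (IsCMField.complexConj L) v))ᵀ = H.map (algebraMap L (LocalRing L v)) := by
      rw [← UnitaryGroup.adelicForm_map_adeleToLocal]; exact map_conjLocal_transpose_localForm L 3 H v hH
    have hh := map_transpose_formCongr (conjLocal L (IsCMField.complexConj L) v) _ hHloc (conjLocal_conjLocal_cm L v) S
    rw [h', Matrix.map_smul', Matrix.transpose_smul] at hh
    · have hq : (((Matrix.of fun i j : Fin 3 => if i.val + j.val + 1 = 3 then (1 : L) else 0).map (algebraMap L (LocalRing L v))).map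
          (conjLocal L (IsCMField.complexConj L) v))ᵀ =
          (Matrix.of fun i j : Fin 3 => if i.val + j.val + 1 = 3 then (1 : L) else 0).map (algebraMap L (LocalRing L v)) :=
        map_conjLocal_transpose_qsForm L v
      rw [hq] at hh
      have h02 := congrFun (congrFun hh 0) 2
      simp only [Matrix.smul_apply, Matrix.map_apply, Matrix.of_apply, smul_eq_mul] at h02
      simpa using h02
    · exact fun x y => map_mul _ x y
  refine ⟨m, hmU, hσm, h', ContinuousMulEquiv.ext fun g => Subtype.ext ?_⟩
  rw [hS g]
  rfl

end Conjugator


end Summit.HodgeConjecture.HodgeConjecture.R90.S7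

end
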